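import Mathlib
import Literature.Analysis.FluidPDE.SuitableWeak
import Summits.NavierStokesRegularity.NavierStokesRegularity.Theorems.EulerZoomLiouvillePowerGaugeEulerLiouvillePressureFloorWeightedVirial
import Summits.NavierStokesRegularity.NavierStokesRegularity.Theorems.EulerZoomLiouvillePowerGaugeEulerLiouvillePressureFloorDeficitKill
import Summits.NavierStokesRegularity.NavierStokesRegularity.Theorems.EulerZoomLiouvillePowerGaugeEulerLiouvillePressureFloorExcessKill
import HarnessLib

/-!
# Crux `EulerZoomLiouville.PowerGaugeEulerLiouville` (stmt-NavierStokesRegularity-19832), line `pressure-floor`: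
# THE TWO SIGN STRATA AT MEMBER LEVEL, with the virial identity (A1) DISCHARGED

Route №10 `EulerZoomLiouville` (NavierStokesRegularity), crux E = Seregin's power-gauged ancient Euler class on
`(−∞,0) × ℝ³`.  Line `pressure-floor` (ideator ns-idea-11; `Cruxes/PowerGaugeEulerLiouville/Lines/pressure_floor.lean`).
The tree now holds A1 (`PressureFloor.weightedVirial_of_inClass`, the slicewise weighted virial identity for every
Newtonian weight, seat ns-sfl-p1), A3 (`PressureFloor.deficitKill`) and A4 (`PressureFloor.excessKill`).  This file
composes them: the pressure-deficit stratum (D) and the pressure-excess stratum (X) of the crux class are trivial for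
`0 < ρ ≤ 1/2`, CONDITIONALLY ONLY on the existence of the Newtonian bump families (A2, `Sig.stub_newtonianBumps` — pure
real analysis about radial Newtonian potentials, no fluid content; carried here as the explicit hypothesis `hA2` in its
registered, unfolded form, so that the member theorems become unconditional by one application the hour A2 lands).

* `ae_eq_zero_of_gauge_of_pressureDeficit` — (D): `p ≥ −ε|u|²` a.e., `ε < ρ/(1+ρ)` ⇒ `u = 0` a.e. (modulo A2);
* `ae_eq_zero_of_gauge_of_pressureExcess` — (X): `p ≤ −κ|u|²` a.e., `κ > 1/(2+2ρ)` ⇒ `u = 0` a.e. (modulo A2);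
* `pressureBalanced_of_nontrivial` — the line's free structural corollary for the lead: a NON-trivial window member is
  pressure-balanced, i.e. neither relative sign condition holds a.e. (modulo A2).

WHAT THIS IS NOT: not NS, not the crux — the two thin sign strata of the crux class (MODEL lattice: 19832 is a class of
Euler-side strata of a hypothetical Type-II zoom limit); the pressure-balanced residue `stub_balancedRest` is the crux
minus these strata and is NOT claimed.  The Seregin–Šverák 2002 dictionary (`ε = 0` ↔ `p ≥ −g`, `κ = ½` ↔ `|u|²+2p ≤ g`)
is docstring-only. [folklore]
-/

noncomputable section

-- flat `Theorems/<Route><Decl>…` files of one crux share the namespace of the crux (tree convention)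
set_option linter.dupNamespace false

open MeasureTheory Set Filter Topology Metric Function
open scoped ENNReal NNReal Laplacian ContDiff

namespace Summit.NavierStokesRegularity.NavierStokesRegularity.Theorems.PowerGaugeEulerLiouville.PressureFloor

open Literature.Analysis Literature.Analysis.FunctionSpaces Literature.Analysis.FluidPDE

variable {u : ℝ → EuclideanSpace ℝ (Fin 3) → EuclideanSpace ℝ (Fin 3)} {p : ℝ → EuclideanSpace ℝ (Fin 3) → ℝ}
  {H : ℝ → EuclideanSpace ℝ (Fin 3) → EuclideanSpace ℝ (Fin 3) →L[ℝ] EuclideanSpace ℝ (Fin 3)} {c : ℝ≥0}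

/-- **Stratum (D) at member level (modulo the bump families A2).**  A member of Seregin's power-gauged ancient Euler
class with `0 < ρ ≤ 1/2` whose pressure has a relative floor `p ≥ −ε|u|²` a.e. on the slab, `ε < ρ/(1+ρ)`, vanishes
a.e. — provided the Newtonian bump families exist at every exponent `β ∈ [0,1)` (hypothesis `hA2` = the line's
`Sig.stub_newtonianBumps`, unfolded).  The virial identity A1 is supplied by `weightedVirial_of_inClass`. [folklore] -/
theorem ae_eq_zero_of_gauge_of_pressureDeficit {ρ : ℝ} (hρ : 0 < ρ) (hρ2 : ρ ≤ 1 / 2)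
    (hsw : IsSuitableWeakSolutionOn (slab (EuclideanSpace ℝ (Fin 3)) (Set.Iio 0) isOpen_Iio) 0 0 u p)
    (hH : HasWeakSpatialGradientOn (slab (EuclideanSpace ℝ (Fin 3)) (Set.Iio 0) isOpen_Iio) u H)
    (hc : ∀ a : ℝ, 0 < a →
      ENNReal.ofReal (a ^ (2 * ρ)) * cknA a (0 : ℝ × EuclideanSpace ℝ (Fin 3)) u +
        ENNReal.ofReal (a ^ ρ) * cknE a (0 : ℝ × EuclideanSpace ℝ (Fin 3)) H +
        ENNReal.ofReal (a ^ (2 * ρ)) * cknD a (0 : ℝ × EuclideanSpace ℝ (Fin 3)) p ≤ (c : ℝ≥0∞))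
    (hA2 : ∀ β : ℝ, 0 ≤ β → β < 1 →
        ∃ C : ℝ, ∀ R : ℝ, 1 ≤ R → ∃ Ψ : EuclideanSpace ℝ (Fin 3) → ℝ,
          (ContDiff ℝ ∞ Ψ ∧ ∃ K : ℝ, ∀ x : EuclideanSpace ℝ (Fin 3),
            |Ψ x| ≤ K / (1 + ‖x‖) ∧ ‖fderiv ℝ Ψ x‖ ≤ K / (1 + ‖x‖) ^ 2 ∧
              ∀ v : EuclideanSpace ℝ (Fin 3),
                |fderiv ℝ (fderiv ℝ Ψ) x v v| ≤ K / (1 + ‖x‖) ^ 3 * ‖v‖ ^ 2) ∧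
          (∀ x : EuclideanSpace ℝ (Fin 3), 0 ≤ Δ Ψ x ∧ Δ Ψ x ≤ (1 + ‖x‖ ^ 2) ^ (-(β / 2))) ∧
          (∀ x : EuclideanSpace ℝ (Fin 3), ‖x‖ ≤ R → Δ Ψ x = (1 + ‖x‖ ^ 2) ^ (-(β / 2))) ∧
          (∀ x : EuclideanSpace ℝ (Fin 3), 2 * R ≤ ‖x‖ → Δ Ψ x = 0) ∧
          (∀ x : EuclideanSpace ℝ (Fin 3), ‖x‖ ≤ R → ∀ v : EuclideanSpace ℝ (Fin 3),
              (1 - β) / (3 - β) * (1 + ‖x‖ ^ 2) ^ (-(β / 2)) * ‖v‖ ^ 2 ≤ fderiv ℝ (fderiv ℝ Ψ) x v v ∧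
                fderiv ℝ (fderiv ℝ Ψ) x v v ≤ 1 / (3 - β) * (1 + ‖x‖ ^ 2) ^ (-(β / 2)) * ‖v‖ ^ 2) ∧
          (∀ x : EuclideanSpace ℝ (Fin 3), R ≤ ‖x‖ → ∀ v : EuclideanSpace ℝ (Fin 3),
              |fderiv ℝ (fderiv ℝ Ψ) x v v| ≤ C * R ^ (3 - β) / ‖x‖ ^ 3 * ‖v‖ ^ 2))
    {ε : ℝ} (hε : ε < ρ / (1 + ρ))
    (hdef : ∀ᵐ z ∂(volume.restrict (Set.Iio (0 : ℝ) ×ˢ (Set.univ : Set (EuclideanSpace ℝ (Fin 3))))),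
      -ε * ‖u z.1 z.2‖ ^ 2 ≤ p z.1 z.2) :
    Function.uncurry u =ᵐ[volume.restrict (Set.Iio (0 : ℝ) ×ˢ (Set.univ : Set (EuclideanSpace ℝ (Fin 3))))] 0 :=
  deficitKill ρ hρ hρ2 u p H c ⟨hsw, hH, hc⟩ (weightedVirial_of_inClass ρ hρ u p H c ⟨hsw, hH, hc⟩) hA2 ε hε hdef

/-- **Stratum (X) at member level (modulo the bump families A2).**  A member of Seregin's power-gauged ancient Euler
class with `0 < ρ ≤ 1/2` whose pressure has a relative ceiling `p ≤ −κ|u|²` a.e. on the slab, `κ > 1/(2+2ρ)`, vanishes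
a.e. — provided the Newtonian bump families exist at every exponent `β ∈ [0,1)` (hypothesis `hA2`).  [folklore] -/
theorem ae_eq_zero_of_gauge_of_pressureExcess {ρ : ℝ} (hρ : 0 < ρ) (hρ2 : ρ ≤ 1 / 2)
    (hsw : IsSuitableWeakSolutionOn (slab (EuclideanSpace ℝ (Fin 3)) (Set.Iio 0) isOpen_Iio) 0 0 u p)
    (hH : HasWeakSpatialGradientOn (slab (EuclideanSpace ℝ (Fin 3)) (Set.Iio 0) isOpen_Iio) u H)
    (hc : ∀ a : ℝ, 0 < a →
      ENNReal.ofReal (a ^ (2 * ρ)) * cknA a (0 : ℝ × EuclideanSpace ℝ (Fin 3)) u +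
        ENNReal.ofReal (a ^ ρ) * cknE a (0 : ℝ × EuclideanSpace ℝ (Fin 3)) H +
        ENNReal.ofReal (a ^ (2 * ρ)) * cknD a (0 : ℝ × EuclideanSpace ℝ (Fin 3)) p ≤ (c : ℝ≥0∞))
    (hA2 : ∀ β : ℝ, 0 ≤ β → β < 1 →
        ∃ C : ℝ, ∀ R : ℝ, 1 ≤ R → ∃ Ψ : EuclideanSpace ℝ (Fin 3) → ℝ,
          (ContDiff ℝ ∞ Ψ ∧ ∃ K : ℝ, ∀ x : EuclideanSpace ℝ (Fin 3),
            |Ψ x| ≤ K / (1 + ‖x‖) ∧ ‖fderiv ℝ Ψ x‖ ≤ K / (1 + ‖x‖) ^ 2 ∧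
              ∀ v : EuclideanSpace ℝ (Fin 3),
                |fderiv ℝ (fderiv ℝ Ψ) x v v| ≤ K / (1 + ‖x‖) ^ 3 * ‖v‖ ^ 2) ∧
          (∀ x : EuclideanSpace ℝ (Fin 3), 0 ≤ Δ Ψ x ∧ Δ Ψ x ≤ (1 + ‖x‖ ^ 2) ^ (-(β / 2))) ∧
          (∀ x : EuclideanSpace ℝ (Fin 3), ‖x‖ ≤ R → Δ Ψ x = (1 + ‖x‖ ^ 2) ^ (-(β / 2))) ∧
          (∀ x : EuclideanSpace ℝ (Fin 3), 2 * R ≤ ‖x‖ → Δ Ψ x = 0) ∧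
          (∀ x : EuclideanSpace ℝ (Fin 3), ‖x‖ ≤ R → ∀ v : EuclideanSpace ℝ (Fin 3),
              (1 - β) / (3 - β) * (1 + ‖x‖ ^ 2) ^ (-(β / 2)) * ‖v‖ ^ 2 ≤ fderiv ℝ (fderiv ℝ Ψ) x v v ∧
                fderiv ℝ (fderiv ℝ Ψ) x v v ≤ 1 / (3 - β) * (1 + ‖x‖ ^ 2) ^ (-(β / 2)) * ‖v‖ ^ 2) ∧
          (∀ x : EuclideanSpace ℝ (Fin 3), R ≤ ‖x‖ → ∀ v : EuclideanSpace ℝ (Fin 3),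
              |fderiv ℝ (fderiv ℝ Ψ) x v v| ≤ C * R ^ (3 - β) / ‖x‖ ^ 3 * ‖v‖ ^ 2))
    {κ : ℝ} (hκ : 1 / (2 + 2 * ρ) < κ)
    (hexc : ∀ᵐ z ∂(volume.restrict (Set.Iio (0 : ℝ) ×ˢ (Set.univ : Set (EuclideanSpace ℝ (Fin 3))))),
      p z.1 z.2 ≤ -κ * ‖u z.1 z.2‖ ^ 2) :
    Function.uncurry u =ᵐ[volume.restrict (Set.Iio (0 : ℝ) ×ˢ (Set.univ : Set (EuclideanSpace ℝ (Fin 3))))] 0 :=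
  excessKill ρ hρ hρ2 u p H c ⟨hsw, hH, hc⟩ (weightedVirial_of_inClass ρ hρ u p H c ⟨hsw, hH, hc⟩) hA2 κ hκ hexc

/-- **The line's free structural corollary (modulo A2): non-trivial window members are PRESSURE-BALANCED.**  If a
member of the class with `0 < ρ ≤ 1/2` is NOT a.e. zero, then for every `ε < ρ/(1+ρ)` the floor `p ≥ −ε|u|²` fails on a
set of positive measure, and for every `κ > 1/(2+2ρ)` the ceiling `p ≤ −κ|u|²` fails on a set of positive measure
(at `ρ = 1/2` both thresholds are `1/3`: the pressure ratio `p/|u|²` crosses `−1/3` in every such member).  Contrapositive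
of the two strata; handed to the lead's partition as bookkeeping. [folklore] -/
theorem pressureBalanced_of_nontrivial {ρ : ℝ} (hρ : 0 < ρ) (hρ2 : ρ ≤ 1 / 2)
    (hsw : IsSuitableWeakSolutionOn (slab (EuclideanSpace ℝ (Fin 3)) (Set.Iio 0) isOpen_Iio) 0 0 u p)
    (hH : HasWeakSpatialGradientOn (slab (EuclideanSpace ℝ (Fin 3)) (Set.Iio 0) isOpen_Iio) u H)
    (hc : ∀ a : ℝ, 0 < a →
      ENNReal.ofReal (a ^ (2 * ρ)) * cknA a (0 : ℝ × EuclideanSpace ℝ (Fin 3)) u +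
        ENNReal.ofReal (a ^ ρ) * cknE a (0 : ℝ × EuclideanSpace ℝ (Fin 3)) H +
        ENNReal.ofReal (a ^ (2 * ρ)) * cknD a (0 : ℝ × EuclideanSpace ℝ (Fin 3)) p ≤ (c : ℝ≥0∞))
    (hA2 : ∀ β : ℝ, 0 ≤ β → β < 1 →
        ∃ C : ℝ, ∀ R : ℝ, 1 ≤ R → ∃ Ψ : EuclideanSpace ℝ (Fin 3) → ℝ,
          (ContDiff ℝ ∞ Ψ ∧ ∃ K : ℝ, ∀ x : EuclideanSpace ℝ (Fin 3),
            |Ψ x| ≤ K / (1 + ‖x‖) ∧ ‖fderiv ℝ Ψ x‖ ≤ K / (1 + ‖x‖) ^ 2 ∧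
              ∀ v : EuclideanSpace ℝ (Fin 3),
                |fderiv ℝ (fderiv ℝ Ψ) x v v| ≤ K / (1 + ‖x‖) ^ 3 * ‖v‖ ^ 2) ∧
          (∀ x : EuclideanSpace ℝ (Fin 3), 0 ≤ Δ Ψ x ∧ Δ Ψ x ≤ (1 + ‖x‖ ^ 2) ^ (-(β / 2))) ∧
          (∀ x : EuclideanSpace ℝ (Fin 3), ‖x‖ ≤ R → Δ Ψ x = (1 + ‖x‖ ^ 2) ^ (-(β / 2))) ∧
          (∀ x : EuclideanSpace ℝ (Fin 3), 2 * R ≤ ‖x‖ → Δ Ψ x = 0) ∧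
          (∀ x : EuclideanSpace ℝ (Fin 3), ‖x‖ ≤ R → ∀ v : EuclideanSpace ℝ (Fin 3),
              (1 - β) / (3 - β) * (1 + ‖x‖ ^ 2) ^ (-(β / 2)) * ‖v‖ ^ 2 ≤ fderiv ℝ (fderiv ℝ Ψ) x v v ∧
                fderiv ℝ (fderiv ℝ Ψ) x v v ≤ 1 / (3 - β) * (1 + ‖x‖ ^ 2) ^ (-(β / 2)) * ‖v‖ ^ 2) ∧
          (∀ x : EuclideanSpace ℝ (Fin 3), R ≤ ‖x‖ → ∀ v : EuclideanSpace ℝ (Fin 3),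
              |fderiv ℝ (fderiv ℝ Ψ) x v v| ≤ C * R ^ (3 - β) / ‖x‖ ^ 3 * ‖v‖ ^ 2))
    (hne : ¬ Function.uncurry u =ᵐ[volume.restrict
      (Set.Iio (0 : ℝ) ×ˢ (Set.univ : Set (EuclideanSpace ℝ (Fin 3))))] 0) :
    (∀ ε : ℝ, ε < ρ / (1 + ρ) →
        ¬ ∀ᵐ z ∂(volume.restrict (Set.Iio (0 : ℝ) ×ˢ (Set.univ : Set (EuclideanSpace ℝ (Fin 3))))),
          -ε * ‖u z.1 z.2‖ ^ 2 ≤ p z.1 z.2) ∧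
      (∀ κ : ℝ, 1 / (2 + 2 * ρ) < κ →
        ¬ ∀ᵐ z ∂(volume.restrict (Set.Iio (0 : ℝ) ×ˢ (Set.univ : Set (EuclideanSpace ℝ (Fin 3))))),
          p z.1 z.2 ≤ -κ * ‖u z.1 z.2‖ ^ 2) :=
  ⟨fun _ hε hdef => hne (ae_eq_zero_of_gauge_of_pressureDeficit hρ hρ2 hsw hH hc hA2 hε hdef),
    fun _ hκ hexc => hne (ae_eq_zero_of_gauge_of_pressureExcess hρ hρ2 hsw hH hc hA2 hκ hexc)⟩

end Summit.NavierStokesRegularity.NavierStokesRegularity.Theorems.PowerGaugeEulerLiouville.PressureFloor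

end
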